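/-
Copyright (c) 2026 the pub-hodgecm-mathlib formalisation cell (harness21).  Prover seat hodgecm-mathlib-LH4-p14 (g0), req620 Track A «(D-RAM) FOUR-FRAME» squad
(heir LEAD F0P3a-plan (g19); dealer LH4-plan (g10) WORD #35 (3); TARGET F of LH4-p11 (g0) 22:12:03Z, first seat of `stub_U3_stableLaw_RU`).  2026-09-03.
-/
import Summits.HodgeConjecture.HodgeConjecture.Theorems.F0P3cDyRamDiagonalBigTube   -- ★ p855091 (this seat, TARGET A): `smul_single_mem_of_mapGL_diagonal_le` (big tube)
import Literature.NumberTheory.Automorphic.UnitaryLatticeTreeTypes                    -- ★ `le_dualLatt_of_isVertexLattice`, `scaleLattice_dualLatt_le_of_isVertexLattice`, `mem_scaleLattice_iff`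
import HarnessLib

/-!
# Crux `H413`, line LH4 «(D-RAM) FOUR-FRAME» road — unit U3_Laws (iii), TIER 2 SUPPORT: «FIXED VERTICES LIVE IN AN EXPLICIT BOX» — `ϖμ·𝒪e_i ⊆ M` and `|μ·x_i| ≤ 1` on `M`
# for every vertex `M` stable under the diagonal torus element, `μ = (s_i − s_j)(s_i − s_k)` (TARGET F of LH4-p11 (g0)'s (S)-reduction)

Cell `hodgecm-mathlib` (D-0151), FLOOR 0, crux item H413 = `stmt-HodgeConjecture-24833`, route of record `HCCMUnconditional`; squad F0∕P3c∕LH4 (req618∕req620).  THEOREMS ONLY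
(no `def`, no instance, no notation, no `sorry`, default heartbeats); lane `--supports stmt-HodgeConjecture-24833 --as helper` (count-neutral).  TARGET F of LH4-p11 (g0)'s
(S)-reduction (DATUM `F0/P3c/LH4/LH4-p11/g0/DATUM-S-RU-dltT-census.v1.LH4p11g0.md` §5), statement BY SIGNATURE as worded on the squad bus 2026-09-03T22:12:03Z.

WHAT IS PROVED (generic valued field `K` with a valuation-preserving `σ`, rank 3).  In the unimodular diagonal model `(K³, h_d)`, `h_d = diag(d)`, `|d_i| = 1`, of a frame
(★ `F0P3cDyRamFixedCountDiagonalModel`), let `T = diag(s)` (`|s_i| ≤ 1`) and let `M` be a VERTEX lattice of any type (`ϖM^♯ ≤ M ≤ M^♯`, ★ `IsVertexLattice`) with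
`diag(s)·M ≤ M`.  Put `μ = (s_i − s_j)(s_i − s_k)` (`{i, j, k} = Fin 3`).  Then (1) `|μ·x_i| ≤ 1` for every `x ∈ M`, and (2) `ϖμ·e_i ∈ M`.  PROOF: the big tube (★ p855091) gives
`y := μ·x_i·e_i ∈ M`; `M ≤ M^♯` gives `h_d(y, y) = σ(μx_i)·d_i·μx_i ∈ 𝒪`, i.e. `|μx_i|² ≤ 1` (1); hence `h_d(x, μe_i) = σ(x_i)·d_i·μ ∈ 𝒪` for all `x ∈ M`, i.e. `μe_i ∈ M^♯`,
and `ϖM^♯ ≤ M` gives (2).  MEANING: slotwise `ϖμ·𝒪³ ⊆ M ⊆ μ⁻¹·𝒪³` — the fixed vertices of the frame element live in an explicit finite box of the tree (radius ≤ the sum of two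
root depths + 1 about the core vertex), the search region of the (S) census.
* `pairing_diagonal_single_right` — `h_d(x, c·e_i) = σ(x_i)·d_i·c`.
* `v_mul_apply_le_one_of_mapGL_diagonal_le` — claim (1).
* `smul_single_one_mem_dualLatt_of_mapGL_diagonal_le` — `μ·e_i ∈ M^♯`.
* **`fixed_vertex_box`** — TARGET F verbatim ((1) ∧ (2)).
HONEST LABEL.  Count-neutral; nothing printed is asserted; the census laws stay PROVER TARGETS; `HC_CM` is proved only modulo the 7 printed citations (2 remaining named inputs:
hLiu418 = `stmt-HodgeConjecture-24832`, h413 = `stmt-HodgeConjecture-24833`) until rung 0 closes.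

## References
* [Kottwitz1986BaseChangeUnits] R. E. Kottwitz, *Base change for unit elements of Hecke algebras*, Compositio Math. 60 (1986), §1 pp. 240–241 (fixed lattices of a torus element).
* [Jacobowitz1962] R. Jacobowitz, *Hermitian forms over local fields*, Amer. J. Math. 84 (1962), §4, §7–§8 (dual lattices, modular lattices).
* [Serre1980Trees] J.-P. Serre, *Trees*, Springer (1980), Ch. II §1.1.
* [BruhatTits1972] F. Bruhat, J. Tits, *Groupes réductifs sur un corps local I*, Publ. Math. IHÉS 41 (1972), §10.
-/

set_option autoImplicit false

noncomputable section

namespace Summit.HodgeConjecture.HodgeConjecture.Cruxes.H413.F0P3cDyRamDiagonalFixedBox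

open Matrix
open Literature.NumberTheory.Automorphic Literature.NumberTheory.Automorphic.HermitianLattice
open Literature.NumberTheory.Automorphic.UnitaryLatticeTree
open Summit.HodgeConjecture.HodgeConjecture.Cruxes.H413.F0P3cDyRamDiagonalBigTube (smul_single_mem_of_mapGL_diagonal_le)
open scoped Valued WithZero Matrix MatrixGroups

variable {K : Type*} [Field K] [Valued K ℤᵐ⁰] {N : ℕ}

omit [Valued K ℤᵐ⁰] in
/-- `h_d(x, c·e_i) = σ(x_i)·d_i·c` for the diagonal form `h_d = diag(d)`. [cite: Jacobowitz1962, §4] -/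
theorem pairing_diagonal_single_right (σ : K →+* K) (d : Fin N → K) (x : Fin N → K) (i : Fin N) (c : K) :
    pairing σ (Matrix.diagonal d) x (Pi.single i c) = σ (x i) * d i * c := by
  rw [pairing_apply, Finset.sum_eq_single i]
  · rw [Finset.sum_eq_single i]
    · rw [Matrix.diagonal_apply_eq, Pi.single_eq_same]
    · intro b _ hb; rw [Pi.single_eq_of_ne hb, mul_zero]
    · exact fun h => absurd (Finset.mem_univ i) h
  · intro a _ ha
    refine Finset.sum_eq_zero fun b _ => ?_
    by_cases hab : a = b
    · subst hab; rw [Pi.single_eq_of_ne ha, mul_zero]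
    · rw [Matrix.diagonal_apply_ne _ hab, mul_zero, zero_mul]
  · exact fun h => absurd (Finset.mem_univ i) h

/-- **CLAIM (1): `|μ·x_i| ≤ 1` on a `diag(s)`-stable vertex lattice**, `μ = (s_i − s_j)(s_i − s_k)`: the big-tube vector `y = μ·x_i·e_i ∈ M` (★ p855091) pairs with itself
to `σ(μx_i)·d_i·μx_i ∈ 𝒪` since `M ≤ M^♯`, and `|d_i| = 1`, `|σ a| = |a|`. [cite: Kottwitz1986BaseChangeUnits, §1 pp. 240–241] [cite: Jacobowitz1962, §7–§8] -/
theorem v_mul_apply_le_one_of_mapGL_diagonal_le {σ : K →+* K} (hvσ : ∀ a, Valued.v (σ a) = Valued.v a) {ϖ : K} {d : Fin 3 → K}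
    (hd : ∀ i, Valued.v (d i) = 1) (s : Fin 3 → K) (hs : ∀ i, Valued.v (s i) ≤ 1) (T : GL (Fin 3) K) (hT : (T : Matrix (Fin 3) (Fin 3) K) = Matrix.diagonal s)
    {t : ℕ} {M : Submodule 𝒪[K] (Fin 3 → K)} (hM : IsVertexLattice σ ϖ (Matrix.diagonal d) t M) (hfix : mapGL T M ≤ M) {i j k : Fin 3} (hij : i ≠ j)
    (hik : i ≠ k) (hjk : j ≠ k) {x : Fin 3 → K} (hx : x ∈ M) : Valued.v ((s i - s j) * (s i - s k) * x i) ≤ 1 := by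
  set μ : K := (s i - s j) * (s i - s k) with hμ
  -- the big-tube vector, rewritten as `(μ x_i) • e_i`
  have hy : μ • (Pi.single i (x i) : Fin 3 → K) ∈ M := smul_single_mem_of_mapGL_diagonal_le s hs T hT M hfix hij hik hjk x hx
  have hyeq : μ • (Pi.single i (x i) : Fin 3 → K) = Pi.single i (μ * x i) := by
    rw [← Pi.single_smul, smul_eq_mul]
  rw [hyeq] at hy
  -- `M ≤ M^♯`: the self-pairing is integral
  have hint := (mem_dualLatt σ (Matrix.diagonal d) M _).1 (le_dualLatt_of_isVertexLattice hvσ hM hy) _ hy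
  rw [pairing_diagonal_single_right, Pi.single_eq_same, map_mul, map_mul, hvσ, hd i, mul_one, ← pow_two] at hint
  exact (pow_le_one_iff two_ne_zero).1 hint

/-- **`μ·e_i ∈ M^♯`** for a `diag(s)`-stable vertex lattice `M`: `h_d(x, μe_i) = σ(x_i)·d_i·μ` has valuation `|μx_i| ≤ 1` for every `x ∈ M` (claim (1)).
[cite: Kottwitz1986BaseChangeUnits, §1 pp. 240–241] [cite: Jacobowitz1962, §7–§8] -/
theorem smul_single_one_mem_dualLatt_of_mapGL_diagonal_le {σ : K →+* K} (hvσ : ∀ a, Valued.v (σ a) = Valued.v a) {ϖ : K} {d : Fin 3 → K}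
    (hd : ∀ i, Valued.v (d i) = 1) (s : Fin 3 → K) (hs : ∀ i, Valued.v (s i) ≤ 1) (T : GL (Fin 3) K) (hT : (T : Matrix (Fin 3) (Fin 3) K) = Matrix.diagonal s)
    {t : ℕ} {M : Submodule 𝒪[K] (Fin 3 → K)} (hM : IsVertexLattice σ ϖ (Matrix.diagonal d) t M) (hfix : mapGL T M ≤ M) {i j k : Fin 3} (hij : i ≠ j)
    (hik : i ≠ k) (hjk : j ≠ k) : ((s i - s j) * (s i - s k)) • (Pi.single i 1 : Fin 3 → K) ∈ dualLatt σ (Matrix.diagonal d) M := by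
  rw [mem_dualLatt]
  intro x hx
  rw [← Pi.single_smul, smul_eq_mul, mul_one, pairing_diagonal_single_right, map_mul, map_mul, hvσ, hd i, mul_one, ← map_mul, mul_comm]
  exact v_mul_apply_le_one_of_mapGL_diagonal_le hvσ hd s hs T hT hM hfix hij hik hjk hx

/-- **«FIXED VERTICES LIVE IN AN EXPLICIT BOX» (TARGET F).**  `h_d = diag(d)` unimodular diagonal (`|d_i| = 1`), `σ` valuation-preserving, `ϖ` a uniformiser, `T = diag(s)` with
`|s_i| ≤ 1`, `M` a vertex lattice of type `t` with `diag(s)·M ≤ M`, `{i, j, k} = Fin 3`, `μ = (s_i − s_j)(s_i − s_k)`: (1) `|μ·x_i| ≤ 1` for all `x ∈ M`; (2) `ϖμ·e_i ∈ M`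
(`μe_i ∈ M^♯` and `ϖM^♯ ≤ M`).  Slotwise `ϖμ·𝒪³ ⊆ M ⊆ μ⁻¹·𝒪³`: the quantitative finiteness box of the fixed set of the frame element (radius ≤ sum of two root depths + 1).
[cite: Kottwitz1986BaseChangeUnits, §1 pp. 240–241] [cite: Jacobowitz1962, §7–§8] [cite: Serre1980Trees, II §1.1] [cite: BruhatTits1972, §10] -/
theorem fixed_vertex_box {K : Type*} [Field K] [Valued K ℤᵐ⁰] {σ : K →+* K} (hvσ : ∀ a, Valued.v (σ a) = Valued.v a) {ϖ : K}
    (hϖ : Valued.v ϖ = WithZero.exp (-1 : ℤ)) {d : Fin 3 → K} (hd : ∀ i, Valued.v (d i) = 1) (s : Fin 3 → K) (hs : ∀ i, Valued.v (s i) ≤ 1) (T : GL (Fin 3) K)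
    (hT : (T : Matrix (Fin 3) (Fin 3) K) = Matrix.diagonal s) {t : ℕ} {M : Submodule 𝒪[K] (Fin 3 → K)} (hM : IsVertexLattice σ ϖ (Matrix.diagonal d) t M)
    (hfix : mapGL T M ≤ M) {i j k : Fin 3} (hij : i ≠ j) (hik : i ≠ k) (hjk : j ≠ k) :
    (∀ x ∈ M, Valued.v ((s i - s j) * (s i - s k) * x i) ≤ 1) ∧ ((ϖ * ((s i - s j) * (s i - s k))) • (Pi.single i 1 : Fin 3 → K) ∈ M) := by
  refine ⟨fun x hx => v_mul_apply_le_one_of_mapGL_diagonal_le hvσ hd s hs T hT hM hfix hij hik hjk hx, ?_⟩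
  have hϖ0 : ϖ ≠ 0 := fun h => by rw [h, map_zero] at hϖ; exact WithZero.zero_ne_coe hϖ
  -- `det diag(d)` is a unit
  have hHd : IsUnit (Matrix.diagonal d).det := by
    rw [Matrix.det_diagonal]
    exact (Finset.prod_ne_zero_iff.2 fun l _ => fun h0 => by have := hd l; rw [h0, map_zero] at this; exact zero_ne_one this).isUnit
  -- `ϖ • (μ • e_i) ∈ ϖ M^♯ ≤ M`
  have hmem : (ϖ * ((s i - s j) * (s i - s k))) • (Pi.single i 1 : Fin 3 → K) ∈ scaleLattice ϖ (dualLatt σ (Matrix.diagonal d) M) := by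
    rw [mem_scaleLattice_iff hϖ0, smul_smul, ← mul_assoc, inv_mul_cancel₀ hϖ0, one_mul]
    exact smul_single_one_mem_dualLatt_of_mapGL_diagonal_le hvσ hd s hs T hT hM hfix hij hik hjk
  exact scaleLattice_dualLatt_le_of_isVertexLattice hvσ hHd hM hmem

end Summit.HodgeConjecture.HodgeConjecture.Cruxes.H413.F0P3cDyRamDiagonalFixedBox

end
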